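import Literature.AlgebraicGeometry.Resolution.LogRefinedChartUnits
import Literature.AlgebraicGeometry.Resolution.LogChartSharpReduction
import Mathlib.RingTheory.Localization.AtPrime.Basic
import HarnessLib

/-!
# The face and the unit/torus splitting at a point of a refined toric chart — Kato (10.3)

`Literature/AlgebraicGeometry/Resolution/LogRefinedChartFace.lean`. Setting of K. Kato, *Toric
singularities*, Amer. J. Math. 116 (1994), (10.3)/(10.4): `φ : P → A` a chart by an fs monoid
`P ⊆ ℤⁿ`, `Q = ℕ^I ⊕ ℤ^{Iᶜ} ⊇ P` the dual monoid of a regular cone of the subdivision (in a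
`ℤ`-basis `b` of `ℤⁿ`), and `χ : Q → C` a monoid homomorphism into an `A`-algebra extending `φ`
(the affine chart `A[χ(Q)]` of the toric modification). At a prime `𝔓` of `C` with
`𝔭 = 𝔓 ∩ A`:

* `unitIdx` — the indices `i` with `χ(bᵢ)` a unit in `C_𝔓` (all of `Iᶜ` and possibly more);
* `mem_faceMonoid_comap_iff` — **the face of `P` at `𝔭` is `P ∩ {bᵢ* = 0, i ∉ U}`**;
* `sigma`, `proj'` — the splitting `ℤⁿ = ⟨bᵢ : i ∉ U⟩ ⊕ H_U` and the projection
  `π' = σ + π₀ ∘ (1 − σ)` killing the face group, used to put the chart in d-form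
  (`LogChartEmbeddedReduction.embChart`) with `π'(bᵢ) = bᵢ` for `i ∉ U`.

References: [Kato1994] K. Kato, Toric singularities, Amer. J. Math. 116 (1994), (5.1), (10.3).
-/

noncomputable section

open IsLocalRing

namespace Literature.AlgebraicGeometry.Resolution

namespace LogRefinedChart

universe u

variable {n : ℕ} {A : Type u} [CommRing A] {P : AddSubmonoid (Fin n → ℤ)}
  {φ : Multiplicative P →* A} {C : Type u} [CommRing C] [Algebra A C]
  {Q : AddSubmonoid (Fin n → ℤ)} {b : Module.Basis (Fin n) ℤ (Fin n → ℤ)} {I : Finset (Fin n)}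

/-! ### The chart monoid homomorphism seen in the local ring `C_𝔓` -/

/-- The chart `χ : Q → C` followed by `C → C_𝔓`. [cite: Kato1994, (10.3)] -/
def chiLoc (χ : Multiplicative Q →* C) (𝔓 : Ideal C) [𝔓.IsPrime] :
    Multiplicative Q →* Localization.AtPrime 𝔓 :=
  (algebraMap C (Localization.AtPrime 𝔓)).toMonoidHom.comp χ

/-- `chiLoc` unfolded. [cite: Kato1994, (10.3)] -/
@[simp] theorem chiLoc_apply (χ : Multiplicative Q →* C) (𝔓 : Ideal C) [𝔓.IsPrime]
    (q : Multiplicative Q) : chiLoc χ 𝔓 q = algebraMap C (Localization.AtPrime 𝔓) (χ q) := rfl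

variable (hQ : IsOrthantLike b I Q) (χ : Multiplicative Q →* C) (𝔓 : Ideal C) [𝔓.IsPrime]

open Classical in
/-- **The unit indices at `𝔓`**: those `i` for which `χ(bᵢ)` is a unit of `C_𝔓`.
[cite: Kato1994, (10.3)] -/
def unitIdx : Finset (Fin n) :=
  Finset.univ.filter fun i => IsUnit (chiLoc χ 𝔓 (Multiplicative.ofAdd ⟨b i, hQ.basis_mem i⟩))

/-- Membership in `unitIdx`. [cite: Kato1994, (10.3)] -/
theorem mem_unitIdx_iff {i : Fin n} :
    i ∈ unitIdx hQ χ 𝔓 ↔ IsUnit (chiLoc χ 𝔓 (Multiplicative.ofAdd ⟨b i, hQ.basis_mem i⟩)) := by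
  classical
  rw [unitIdx, Finset.mem_filter]
  simp

/-- At unit indices `χ(bᵢ)` is a unit in `C_𝔓`. [cite: Kato1994, (10.3)] -/
theorem isUnit_of_mem_unitIdx :
    ∀ i ∈ unitIdx hQ χ 𝔓, IsUnit (chiLoc χ 𝔓 (Multiplicative.ofAdd ⟨b i, hQ.basis_mem i⟩)) :=
  fun _ hi => (mem_unitIdx_iff hQ χ 𝔓).1 hi

/-- The torus indices `Iᶜ` are unit indices (`−bᵢ ∈ Q` there). [cite: Kato1994, (10.3)] -/
theorem mem_unitIdx_of_not_mem {i : Fin n} (hi : i ∉ I) : i ∈ unitIdx hQ χ 𝔓 := by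
  rw [mem_unitIdx_iff]
  refine IsUnit.of_mul_eq_one (chiLoc χ 𝔓 (Multiplicative.ofAdd ⟨-b i, hQ.neg_basis_mem hi⟩)) ?_
  rw [← map_mul, ← ofAdd_add]
  have : (⟨b i, hQ.basis_mem i⟩ : Q) + ⟨-b i, hQ.neg_basis_mem hi⟩ = 0 := by
    apply Subtype.ext; simp
  rw [this, ofAdd_zero, map_one]

/-- Outside the unit indices we are inside `I`. [cite: Kato1994, (10.3)] -/
theorem mem_of_not_mem_unitIdx {i : Fin n} (hi : i ∉ unitIdx hQ χ 𝔓) : i ∈ I := by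
  by_contra h; exact hi (mem_unitIdx_of_not_mem hQ χ 𝔓 h)

/-- Outside the unit indices `χ(bᵢ)` lies in the maximal ideal of `C_𝔓`. [cite: Kato1994, (10.3)] -/
theorem chiLoc_mem_maximalIdeal {i : Fin n} (hi : i ∉ unitIdx hQ χ 𝔓) :
    chiLoc χ 𝔓 (Multiplicative.ofAdd ⟨b i, hQ.basis_mem i⟩) ∈
      maximalIdeal (Localization.AtPrime 𝔓) := by
  rw [mem_unitIdx_iff] at hi
  exact (mem_maximalIdeal _).2 (mem_nonunits_iff.2 hi)

/-- **The unit part at `𝔓`**: `x ↦ ∏_{i ∈ U} χ(bᵢ)^{xᵢ} ∈ (C_𝔓)ˣ` on all of `ℤⁿ`.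
[cite: Kato1994, (10.3)] -/
def unitPartAt : (Fin n → ℤ) →+ Additive (Localization.AtPrime 𝔓)ˣ :=
  unitPart hQ (chiLoc χ 𝔓) (unitIdx hQ χ 𝔓) (isUnit_of_mem_unitIdx hQ χ 𝔓)

/-- **Factorisation at `𝔓`**: `χ(q) = ∏_{i ∉ U} χ(bᵢ)^{qᵢ} · (unit part)` in `C_𝔓`.
[cite: Kato1994, (10.3)] -/
theorem chiLoc_eq_prod_mul_unitPartAt (q : Fin n → ℤ) (hq : q ∈ Q) :
    chiLoc χ 𝔓 (Multiplicative.ofAdd ⟨q, hq⟩) =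
      (∏ i ∈ (unitIdx hQ χ 𝔓)ᶜ,
          chiLoc χ 𝔓 (Multiplicative.ofAdd ⟨b i, hQ.basis_mem i⟩) ^ (b.repr q i).toNat) *
        ((Additive.toMul (unitPartAt hQ χ 𝔓 q) : (Localization.AtPrime 𝔓)ˣ) :
          Localization.AtPrime 𝔓) :=
  monoidHom_apply_eq_prod_mul_unitPart hQ (chiLoc χ 𝔓) (unitIdx hQ χ 𝔓)
    (isUnit_of_mem_unitIdx hQ χ 𝔓) (fun _ hi => mem_unitIdx_of_not_mem hQ χ 𝔓 hi) q hq

/-- The unit part on a unit-index basis vector is `χ(bᵢ)`. [cite: Kato1994, (10.3)] -/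
theorem coe_unitPartAt_basis {i : Fin n} (hi : i ∈ unitIdx hQ χ 𝔓) :
    ((Additive.toMul (unitPartAt hQ χ 𝔓 (b i)) : (Localization.AtPrime 𝔓)ˣ) :
        Localization.AtPrime 𝔓) =
      chiLoc χ 𝔓 (Multiplicative.ofAdd ⟨b i, hQ.basis_mem i⟩) :=
  coe_unitPart_basis hQ (chiLoc χ 𝔓) (unitIdx hQ χ 𝔓) (isUnit_of_mem_unitIdx hQ χ 𝔓) hi

/-- If all unit-index coordinates of `x` vanish, its unit part is trivial. [cite: Kato1994, (10.3)] -/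
theorem unitPartAt_eq_zero {x : Fin n → ℤ} (hx : ∀ i ∈ unitIdx hQ χ 𝔓, b.repr x i = 0) :
    unitPartAt hQ χ 𝔓 x = 0 :=
  unitPart_eq_zero_of_repr_eq_zero hQ (chiLoc χ 𝔓) (unitIdx hQ χ 𝔓)
    (isUnit_of_mem_unitIdx hQ χ 𝔓) hx

/-- `χ(q)` is a unit in `C_𝔓` iff the non-unit-index coordinates of `q` vanish, and then it is
its unit part. [cite: Kato1994, (10.3)] -/
theorem isUnit_chiLoc_iff (q : Fin n → ℤ) (hq : q ∈ Q) :
    IsUnit (chiLoc χ 𝔓 (Multiplicative.ofAdd ⟨q, hq⟩)) ↔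
      ∀ i, i ∉ unitIdx hQ χ 𝔓 → b.repr q i = 0 := by
  classical
  rw [chiLoc_eq_prod_mul_unitPartAt hQ χ 𝔓 q hq, IsUnit.mul_iff, and_iff_left (Units.isUnit _)]
  constructor
  · intro h i hi
    have hmem : i ∈ (unitIdx hQ χ 𝔓)ᶜ := Finset.mem_compl.2 hi
    rw [← Finset.mul_prod_erase _ _ hmem, IsUnit.mul_iff] at h
    have h1 := h.1
    by_contra hne
    have hpos : (b.repr q i).toNat ≠ 0 := by
      have hnn : 0 ≤ b.repr q i := (hQ.mem_iff q).1 hq i (mem_of_not_mem_unitIdx hQ χ 𝔓 hi)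
      intro h0
      rw [Int.toNat_eq_zero] at h0
      exact hne (le_antisymm h0 hnn)
    rw [isUnit_pow_iff hpos] at h1
    exact hi ((mem_unitIdx_iff hQ χ 𝔓).2 h1)
  · intro h
    rw [Finset.prod_eq_one]
    · exact isUnit_one
    · intro i hi
      rw [h i (Finset.mem_compl.1 hi), Int.toNat_zero, pow_zero]

/-! ### The face of `P` at `𝔭 = 𝔓 ∩ A` -/

variable (hPQ : P ≤ Q)
  (hχ : ∀ p : P, χ (Multiplicative.ofAdd ⟨(p : Fin n → ℤ), hPQ p.2⟩) =
    algebraMap A C (φ (Multiplicative.ofAdd p)))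

/-- The prime `𝔭 = 𝔓 ∩ A` of the base. [cite: Kato1994, (10.3)] -/
instance isPrime_comap : (𝔓.comap (algebraMap A C)).IsPrime := Ideal.IsPrime.comap _

include hχ in
/-- On `P`, `χ` is the base chart: `χ(p) = φ(p)` in `C_𝔓`. [cite: Kato1994, (10.3)] -/
theorem chiLoc_of_mem (p : Fin n → ℤ) (hp : p ∈ P) :
    chiLoc χ 𝔓 (Multiplicative.ofAdd ⟨p, hPQ hp⟩) =
      algebraMap C (Localization.AtPrime 𝔓) (algebraMap A C (LogChart.val P φ p)) := by
  rw [chiLoc_apply, LogChart.val_of_mem P φ hp]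
  exact congrArg _ (hχ ⟨p, hp⟩)

include hχ in
/-- **The face at `𝔭 = 𝔓 ∩ A` in coordinates**: `p ∈ F_𝔭 ⟺ p ∈ P` and `bᵢ*(p) = 0` for all
non-unit indices `i`. [cite: Kato1994, (5.1), (10.3)] -/
theorem mem_faceMonoid_comap_iff (p : Fin n → ℤ) :
    p ∈ LogChart.faceMonoid P φ (𝔓.comap (algebraMap A C)) ↔
      p ∈ P ∧ ∀ i, i ∉ unitIdx hQ χ 𝔓 → b.repr p i = 0 := by
  rw [LogChart.mem_faceMonoid]
  refine and_congr_right fun hp => ?_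
  rw [← isUnit_chiLoc_iff hQ χ 𝔓 p (hPQ hp), chiLoc_of_mem χ 𝔓 hPQ hχ p hp,
    IsLocalization.AtPrime.isUnit_to_map_iff (Localization.AtPrime 𝔓) 𝔓, Ideal.mem_comap]
  rfl

include hχ in
/-- Face elements have trivial non-unit coordinates. [cite: Kato1994, (5.1)] -/
theorem repr_eq_zero_of_mem_faceMonoid {p : Fin n → ℤ}
    (hp : p ∈ LogChart.faceMonoid P φ (𝔓.comap (algebraMap A C))) {i : Fin n}
    (hi : i ∉ unitIdx hQ χ 𝔓) : b.repr p i = 0 :=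
  ((mem_faceMonoid_comap_iff hQ χ 𝔓 hPQ hχ p).1 hp).2 i hi

include hχ in
/-- On the face, `χ = φ` is the unit part. [cite: Kato1994, (10.3)] -/
theorem chiLoc_eq_unitPartAt_of_mem_faceMonoid {f : Fin n → ℤ}
    (hf : f ∈ LogChart.faceMonoid P φ (𝔓.comap (algebraMap A C))) :
    algebraMap C (Localization.AtPrime 𝔓) (algebraMap A C (LogChart.val P φ f)) =
      ((Additive.toMul (unitPartAt hQ χ 𝔓 f) : (Localization.AtPrime 𝔓)ˣ) :
        Localization.AtPrime 𝔓) := by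
  have hfP : f ∈ P := hf.1
  rw [← chiLoc_of_mem χ 𝔓 hPQ hχ f hfP, chiLoc_eq_prod_mul_unitPartAt hQ χ 𝔓 f (hPQ hfP),
    Finset.prod_eq_one, one_mul]
  intro i hi
  rw [repr_eq_zero_of_mem_faceMonoid hQ χ 𝔓 hPQ hχ hf (Finset.mem_compl.1 hi), Int.toNat_zero,
    pow_zero]

/-! ### The splitting `ℤⁿ = ⟨bᵢ : i ∉ U⟩ ⊕ H_U` -/

/-- **The non-unit part** `σ(x) = Σ_{i ∉ U} bᵢ*(x) bᵢ`. [cite: Kato1994, (10.3)] -/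
def sigma : (Fin n → ℤ) →ₗ[ℤ] (Fin n → ℤ) :=
  ∑ i ∈ (unitIdx hQ χ 𝔓)ᶜ, (b.coord i).smulRight (b i)

/-- Coordinates of `σ(x)`. [cite: Kato1994, (10.3)] -/
theorem repr_sigma (x : Fin n → ℤ) (j : Fin n) :
    b.repr (sigma hQ χ 𝔓 x) j = if j ∈ unitIdx hQ χ 𝔓 then 0 else b.repr x j := by
  classical
  simp only [sigma, LinearMap.coe_sum, Finset.sum_apply, LinearMap.smulRight_apply,
    Module.Basis.coord_apply, map_sum, map_zsmul, Module.Basis.repr_self, Finsupp.coe_finsetSum,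
    Finsupp.smul_apply, Finsupp.single_apply, smul_eq_mul, mul_ite, mul_one, mul_zero]
  rw [Finset.sum_ite_eq' ((unitIdx hQ χ 𝔓)ᶜ) j (fun i => b.repr x i)]
  simp only [Finset.mem_compl]
  split_ifs <;> simp_all

/-- `σ` fixes `bᵢ` for non-unit `i`. [cite: Kato1994, (10.3)] -/
theorem sigma_basis_of_not_mem {i : Fin n} (hi : i ∉ unitIdx hQ χ 𝔓) :
    sigma hQ χ 𝔓 (b i) = b i := by
  apply b.repr.injective; ext j
  rw [repr_sigma, Module.Basis.repr_self_apply]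
  split_ifs with h1 h2 <;> simp_all

/-- `σ` kills vectors with vanishing non-unit coordinates (the subgroup `H_U`).
[cite: Kato1994, (10.3)] -/
theorem sigma_eq_zero_of_repr {y : Fin n → ℤ} (hy : ∀ i, i ∉ unitIdx hQ χ 𝔓 → b.repr y i = 0) :
    sigma hQ χ 𝔓 y = 0 := by
  apply b.repr.injective; ext j
  rw [repr_sigma, map_zero, Finsupp.zero_apply]
  split_ifs with h
  · rfl
  · exact hy j h

/-- `x − σ(x)` has vanishing non-unit coordinates. [cite: Kato1994, (10.3)] -/
theorem repr_sub_sigma_eq_zero (x : Fin n → ℤ) {i : Fin n} (hi : i ∉ unitIdx hQ χ 𝔓) :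
    b.repr (x - sigma hQ χ 𝔓 x) i = 0 := by
  rw [map_sub, Finsupp.sub_apply, repr_sigma, if_neg hi, sub_self]

/-- `σ(x)` has vanishing unit coordinates. [cite: Kato1994, (10.3)] -/
theorem repr_sigma_eq_zero_of_mem (x : Fin n → ℤ) {i : Fin n} (hi : i ∈ unitIdx hQ χ 𝔓) :
    b.repr (sigma hQ χ 𝔓 x) i = 0 := by
  rw [repr_sigma, if_pos hi]

/-- `σ` is idempotent. [cite: Kato1994, (10.3)] -/
theorem sigma_sigma (x : Fin n → ℤ) : sigma hQ χ 𝔓 (sigma hQ χ 𝔓 x) = sigma hQ χ 𝔓 x := by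
  apply b.repr.injective; ext j
  rw [repr_sigma, repr_sigma]
  split_ifs <;> rfl

/-- The unit part of `σ(x)` is trivial. [cite: Kato1994, (10.3)] -/
theorem unitPartAt_sigma (x : Fin n → ℤ) : unitPartAt hQ χ 𝔓 (sigma hQ χ 𝔓 x) = 0 :=
  unitPartAt_eq_zero hQ χ 𝔓 fun _ hi => repr_sigma_eq_zero_of_mem hQ χ 𝔓 x hi

include hχ in
/-- `σ` kills the face group `ℤ F_𝔭`. [cite: Kato1994, (5.1)] -/
theorem sigma_eq_zero_of_mem_span {v : Fin n → ℤ}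
    (hv : v ∈ Submodule.span ℤ
      (LogChart.faceMonoid P φ (𝔓.comap (algebraMap A C)) : Set (Fin n → ℤ))) :
    sigma hQ χ 𝔓 v = 0 := by
  obtain ⟨f₁, hf₁, f₂, hf₂, rfl⟩ := (LogChart.mem_span_int_iff_exists_sub _).1 hv
  rw [map_sub, sigma_eq_zero_of_repr hQ χ 𝔓 fun i hi =>
      repr_eq_zero_of_mem_faceMonoid hQ χ 𝔓 hPQ hχ hf₁ hi,
    sigma_eq_zero_of_repr hQ χ 𝔓 fun i hi => repr_eq_zero_of_mem_faceMonoid hQ χ 𝔓 hPQ hχ hf₂ hi,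
    sub_zero]

/-! ### The adapted projection `π' = σ + π₀ ∘ (1 − σ)` -/

variable (π₀ : (Fin n → ℤ) →ₗ[ℤ] (Fin n → ℤ))

/-- **The adapted splitting** `π' = σ + π₀ ∘ (1 − σ)` of the face group, for a splitting `π₀` as
in `LogChart.IsFaceOf.exists_proj`. [cite: Kato1994, (5.1), (10.3)] -/
def proj' : (Fin n → ℤ) →ₗ[ℤ] (Fin n → ℤ) :=
  sigma hQ χ 𝔓 + π₀ ∘ₗ (LinearMap.id - sigma hQ χ 𝔓)

/-- `π'` unfolded. [cite: Kato1994, (10.3)] -/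
theorem proj'_apply (x : Fin n → ℤ) :
    proj' hQ χ 𝔓 π₀ x = sigma hQ χ 𝔓 x + π₀ (x - sigma hQ χ 𝔓 x) := rfl

include hχ in
/-- `π'` kills the face group. [cite: Kato1994, (5.1)] -/
theorem proj'_eq_zero_of_mem_span
    (hπ₀0 : ∀ v ∈ Submodule.span ℤ
      (LogChart.faceMonoid P φ (𝔓.comap (algebraMap A C)) : Set (Fin n → ℤ)), π₀ v = 0)
    {v : Fin n → ℤ}
    (hv : v ∈ Submodule.span ℤ
      (LogChart.faceMonoid P φ (𝔓.comap (algebraMap A C)) : Set (Fin n → ℤ))) :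
    proj' hQ χ 𝔓 π₀ v = 0 := by
  rw [proj'_apply, sigma_eq_zero_of_mem_span hQ χ 𝔓 hPQ hχ hv, zero_add, sub_zero, hπ₀0 v hv]

/-- `v − π'(v)` lies in the face group. [cite: Kato1994, (5.1)] -/
theorem sub_proj'_mem_span
    (hπ₀1 : ∀ v, v - π₀ v ∈ Submodule.span ℤ
      (LogChart.faceMonoid P φ (𝔓.comap (algebraMap A C)) : Set (Fin n → ℤ)))
    (v : Fin n → ℤ) :
    v - proj' hQ χ 𝔓 π₀ v ∈ Submodule.span ℤ
      (LogChart.faceMonoid P φ (𝔓.comap (algebraMap A C)) : Set (Fin n → ℤ)) := by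
  rw [proj'_apply, show v - (sigma hQ χ 𝔓 v + π₀ (v - sigma hQ χ 𝔓 v)) =
    (v - sigma hQ χ 𝔓 v) - π₀ (v - sigma hQ χ 𝔓 v) by abel]
  exact hπ₀1 _

/-- `π'(bᵢ) = bᵢ` for non-unit `i`. [cite: Kato1994, (10.3)] -/
theorem proj'_basis_of_not_mem {i : Fin n} (hi : i ∉ unitIdx hQ χ 𝔓) :
    proj' hQ χ 𝔓 π₀ (b i) = b i := by
  rw [proj'_apply, sigma_basis_of_not_mem hQ χ 𝔓 hi, sub_self, map_zero, add_zero]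

/-- On `H_U` (vanishing non-unit coordinates), `π' = π₀`. [cite: Kato1994, (10.3)] -/
theorem proj'_of_repr {y : Fin n → ℤ} (hy : ∀ i, i ∉ unitIdx hQ χ 𝔓 → b.repr y i = 0) :
    proj' hQ χ 𝔓 π₀ y = π₀ y := by
  rw [proj'_apply, sigma_eq_zero_of_repr hQ χ 𝔓 hy, zero_add, sub_zero]

end LogRefinedChart

end Literature.AlgebraicGeometry.Resolution
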